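import Summits.QuantumFields.BalabanUV.Beta.D1BFx.NeedleRowsAtRay
import Summits.QuantumFields.BalabanUV.Beta.D1BFx.NeedleGhostTadpoleRowMass8

/-!
# `BalabanUV.Beta.D1BFx.NeedleRowsAtRayS` — road «BF-x», binder row D1, slot (K), END row `hGrp gN`, variant «ENDₛ» ∕ reading (ii): **THE GHOST NEEDLE
# ROWS' SCALING LETTERS AT THE RAY UNDER THE RESCALED TIE** (`hωs : ω_gh n·(s n·cK n)² = −2·ω_gl n·cE n²` with the pin `s n = n⁻²`, `hlam : ω_gl·cE² = 2N²·n⁸`,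
# ray `cK = cgh·n²`, `cQ = cgh·a`, `x₀ = −cgh`): `ω_gh·cgh² = −4N²·n⁸`, hence `|ω_gh·x₀·cQ| = 4N²a·n⁸` (T₇), `|ω_gh·cK·cQ| = 4N²a·n¹⁰` (T₄∕T₅), `|ω_gh·cQ²| = 4N²a²·n⁸`
# (T₆) — the END-ii letters of `END-ii-SPEC.md` v1.1 §3 (c) — and **T₇-ii AT THE RAY** from leaf-04-g12's tolerance-`n⁸` closer `NeedleGhostTadpoleRowMass8.h₇_of_scaling₈`

HONEST DEPENDENCY (cell records, verbatim): «continuum YM on T⁴ ⇐ BetaPertH ∧ nine spine estimates (0/9 proved); BetaPertH ⇐ (D1) ∧ (D4) ∧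
CAP+tail; G-an2-4 gates asym, D1 and NE2/3/4.»  HONEST FRAMING (cell contract, verbatim): «discharging `BetaPertH` makes Bałaban's UV stability
UNCONDITIONAL — a real constructive-QFT result; it is NOT the continuum limit and NOT the Clay problem.»  THIS MODULE DISCHARGES NOTHING of the wall:
[folklore] arithmetic BY NAME (the three weight products at the ray under the rescaled tie) and ONE composition with leaf-04-g12's `h₇_of_scaling₈`.  The ray
pins, the tie, the normalisation and the pin `s n = n⁻²` stay DISPLAYED hypotheses (CHECK-N0 ∕ (K): asserted nowhere).  No `def`, nothing cited, 0 sorry.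
0 wall binders (root-level hW ∕ hR-sockets ∕ hSX-socket ∕ D1Tel ∕ D1Rep — 0); (K) NOT closed; NOT D1, NOT `BetaPertH`, NOT continuum, NOT Clay.

ABSOLUTE RULE (cell charter, verbatim): «No internally-minted statement may enter as a cited fact. Every hypothesis is either kernel-proved in this
package or a verbatim quotation of a PUBLISHED theorem with page reference. The manuscript(s) under audit are NOT citable for their own disputed
steps — they are the thing under adjudication; programme-internal (2001/route/tribunal) claims are never citable.»

WHY (owner ruling ρ-g11-9 «GHOST UNITS», an3-g63's audit; `END-ii-SPEC.md` v1.1 §3 (c); `NeedleRowsAtRay` is the same file under the tie of record `hω`, whose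
letters are `n⁴` smaller and whose rows T₄–T₇ «met at the ray» are void for Bałaban's kernels).  Under reading (ii) the tie is `ω_gh·(n⁻²·cK)² = −2·ω_gl·cE²`; at
the ray `n⁻²·cK n = cgh n`, so `ω_gh n·cgh n² = −2·ω_gl n·cE n² = −4N²·n⁸` and the three ghost weight products are EXACTLY `4N²a·n⁸`, `−4N²a·n¹⁰`, `−4N²a²·n⁸`.
These are the letters the tolerance rows consume: T₇-ii = `NeedleGhostTadpoleRowMass8.h₇_of_scaling₈` (`k·n⁸`, IN TREE — composed here, §2), T₄∕T₅-ii =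
leaf-01-g16's `NeedleGhostBubbleRowMass10{,T5}.h₄∕h₅_of_scaling₁₀` (`k·n¹⁰`), T₆-ii = gan24-leaf-05-g44's `NeedleGhostBubble2RowMass8.h₆_of_scaling₈` (`k·n⁸`) —
§§4–6 are APPENDED when those closers land (their letters are §3 here, ready).

CONTENT.
* §1 [folklore] `ωgh_mul_cgh_sq_of_rayS` (`ω_gh·cgh² = −4N²·n⁸`), `weight₇_eq_of_rayS` (`ω_gh·(x₀·cQ) = 4N²a·n⁸`), `abs_weight₇_le_of_rayS`.
* §2 [folklore] **`h₇_of_rayS`** — `h₇` of `NeedleRowGlue.abs_gN_row_le_of_tables` VERBATIM with `C₇ := 4N²a·(2·cNear a)`; displayed ONLY `0 < a`, `hωs`, `hs`, `hlam` and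
  the three ray pins.
* §3 [folklore] `abs_weight₄_le_of_rayS` ∕ `abs_weight₅_le_of_rayS` (`≤ 4N²a·n¹⁰`), `abs_weight₆_le_of_rayS` (`≤ 4N²a²·n⁸`) — the letters of T₄∕T₅∕T₆-ii.
Unit `b2b-balaban-beta-d1-p2` (gen 12), road «BF-x» OWNER, BINDER-OWNERS row D1 co-owner; `LEAVES-BFx.md` row «ROWS-AT-RAY-S»; END-ii-SPEC v1.1 §3 (c).
-/

noncomputable section

namespace Summit.QuantumFields.BalabanUV.Beta.D1BFx.NeedleRowsAtRayS

open Finset Filter Topology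
open scoped BigOperators
open Literature.MathematicalPhysics.QuantumFieldTheory.Balaban1983to89
open Literature.MathematicalPhysics.QuantumFieldTheory.Balaban1983to89.Beta
open DyadicShell (Pt toReal)
open WindowIdentification (fullSum)
open DressedMomentNormalisation (resSite)
open Summit.QuantumFields.BalabanUV.Beta.D1BFx.DressedTablesLeg (tadpoleTableA)
open Summit.QuantumFields.BalabanUV.Beta.D1BFx.GhostLeg (Ggh)
open Summit.QuantumFields.BalabanUV.Beta.D1BFx.GhostStencilRootedReflection (ctrHalf)
open Summit.QuantumFields.BalabanUV.Beta.D1BFx.GhostAveragingSquare (WghAt)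
open Summit.QuantumFields.BalabanUV.Beta.D1BFx.GhostLegBlockMass (cNear)
open Summit.QuantumFields.BalabanUV.Beta.D1BFx.NeedleGhostTadpoleRowMass8 (h₇_of_scaling₈)

variable {a N : ℝ} {x₀ cK cQ cE cgh ωgl ωgh s : ℕ → ℝ}

/-! ## §1 The core product and the T₇ weight at the ray under the rescaled tie -/

/-- [folklore] **`ω_gh n·cgh n² = −4N²·n⁸` AT THE RAY UNDER THE RESCALED TIE** (`hωs` with the pin `s n = n⁻²`, `hlam`, `cK = cgh·n²`): the common core of
the three ghost weight products of reading (ii).  (Under the tie of record the same core was `−4N²·n⁴`, `NeedleRowsAtRay.ωgh_mul_cgh_sq_of_ray`.) -/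
theorem ωgh_mul_cgh_sq_of_rayS (hωs : ∀ n : ℕ, 2 ≤ n → ωgh n * (s n * cK n) ^ 2 = -2 * (ωgl n * cE n ^ 2))
    (hs : ∀ n : ℕ, 2 ≤ n → s n = ((n : ℝ) ^ 2)⁻¹)
    (hlam : ∀ n : ℕ, 2 ≤ n → ωgl n * cE n ^ 2 = 2 * N ^ 2 * (n : ℝ) ^ 8) (hK : ∀ n : ℕ, cK n = cgh n * (n : ℝ) ^ 2)
    (n : ℕ) (hn : 2 ≤ n) : ωgh n * cgh n ^ 2 = -(4 * N ^ 2 * (n : ℝ) ^ 8) := by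
  have hn0 : (n : ℝ) ≠ 0 := by exact_mod_cast (show n ≠ 0 by omega)
  have h2 : ((n : ℝ) ^ 2)⁻¹ * (n : ℝ) ^ 2 = 1 := inv_mul_cancel₀ (pow_ne_zero 2 hn0)
  have hsK : s n * cK n = cgh n := by
    rw [hs n hn, hK n, mul_comm (cgh n), ← mul_assoc, h2, one_mul]
  have h := hωs n hn
  rw [hsK, hlam n hn] at h
  linarith

/-- [folklore] **THE T₇ WEIGHT PRODUCT AT THE RAY, READING (ii)**: `ω_gh n·(x₀ n·cQ n) = 4N²a·n⁸` (every `n ≥ 2`; `cgh n` drops out, zero or not). -/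
theorem weight₇_eq_of_rayS (hωs : ∀ n : ℕ, 2 ≤ n → ωgh n * (s n * cK n) ^ 2 = -2 * (ωgl n * cE n ^ 2))
    (hs : ∀ n : ℕ, 2 ≤ n → s n = ((n : ℝ) ^ 2)⁻¹)
    (hlam : ∀ n : ℕ, 2 ≤ n → ωgl n * cE n ^ 2 = 2 * N ^ 2 * (n : ℝ) ^ 8)
    (hK : ∀ n : ℕ, cK n = cgh n * (n : ℝ) ^ 2) (hQ : ∀ n : ℕ, cQ n = cgh n * a) (hx : ∀ n : ℕ, x₀ n = -cgh n)
    (n : ℕ) (hn : 2 ≤ n) : ωgh n * (x₀ n * cQ n) = 4 * N ^ 2 * a * (n : ℝ) ^ 8 := by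
  have h2 := ωgh_mul_cgh_sq_of_rayS hωs hs hlam hK n hn
  rw [hx n, hQ n]
  have e : ωgh n * (-cgh n * (cgh n * a)) = -(ωgh n * cgh n ^ 2) * a := by ring
  rw [e, h2]
  ring

/-- [folklore] Hence the tolerance-`n⁸` row's scaling letter holds with `k = 4N²a` (`0 ≤ a`). -/
theorem abs_weight₇_le_of_rayS (ha : 0 ≤ a) (hωs : ∀ n : ℕ, 2 ≤ n → ωgh n * (s n * cK n) ^ 2 = -2 * (ωgl n * cE n ^ 2))
    (hs : ∀ n : ℕ, 2 ≤ n → s n = ((n : ℝ) ^ 2)⁻¹)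
    (hlam : ∀ n : ℕ, 2 ≤ n → ωgl n * cE n ^ 2 = 2 * N ^ 2 * (n : ℝ) ^ 8)
    (hK : ∀ n : ℕ, cK n = cgh n * (n : ℝ) ^ 2) (hQ : ∀ n : ℕ, cQ n = cgh n * a) (hx : ∀ n : ℕ, x₀ n = -cgh n) :
    ∀ n : ℕ, 2 ≤ n → |ωgh n * (x₀ n * cQ n)| ≤ 4 * N ^ 2 * a * (n : ℝ) ^ 8 := by
  intro n hn
  rw [weight₇_eq_of_rayS hωs hs hlam hK hQ hx n hn, abs_of_nonneg (by positivity)]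

/-! ## §2 The T₇ row at the ray, reading (ii) (leaf-04-g12's tolerance-`n⁸` closer) -/

/-- [folklore] **THE COMPLETED GHOST TADPOLE ROW `h₇` AT THE RAY, READING (ii)**: `h₇` of `NeedleRowGlue.abs_gN_row_le_of_tables` VERBATIM with
`C₇ := 4N²a·(2·cNear a)`; displayed `0 < a`, the RESCALED tie `hωs` with the pin `hs`, `hlam`, and the ghost ray pins `cK = cgh·n²`, `cQ = cgh·a`, `x₀ = −cgh`
— `NeedleGhostTadpoleRowMass8.h₇_of_scaling₈` with its letter computed here (`k := 4N²a`). -/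
theorem h₇_of_rayS (ha : 0 < a) (hωs : ∀ n : ℕ, 2 ≤ n → ωgh n * (s n * cK n) ^ 2 = -2 * (ωgl n * cE n ^ 2))
    (hs : ∀ n : ℕ, 2 ≤ n → s n = ((n : ℝ) ^ 2)⁻¹)
    (hlam : ∀ n : ℕ, 2 ≤ n → ωgl n * cE n ^ 2 = 2 * N ^ 2 * (n : ℝ) ^ 8)
    (hK : ∀ n : ℕ, cK n = cgh n * (n : ℝ) ^ 2) (hQ : ∀ n : ℕ, cQ n = cgh n * a) (hx : ∀ n : ℕ, x₀ n = -cgh n) (μ ν : Fin 4) :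
    ∀ n : ℕ, 2 ≤ n → ∀ [NeZero n], |ωgh n * ∑ b ∈ (univ : Finset (Fin 4 → Fin n)).image resSite, ((n : ℝ) ^ 4)⁻¹ * (((n : ℝ) ^ 8)⁻¹ *
      fullSum (fun w : Pt => toReal w μ * toReal w ν *
        tadpoleTableA (Ggh n a) (WghAt (ctrHalf n) n (x₀ n) (cK n) (cQ n)) μ ν (b + w) b))| ≤ 4 * N ^ 2 * a * (2 * cNear a) :=
  h₇_of_scaling₈ ha (abs_weight₇_le_of_rayS ha.le hωs hs hlam hK hQ hx) μ ν

/-! ## §3 The T₄∕T₅ and T₆ weight letters at the ray, reading (ii) -/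

/-- [folklore] **THE T₄∕T₅ WEIGHT PRODUCT AT THE RAY, READING (ii)**: `ω_gh n·(cK n·cQ n) = −4N²a·n¹⁰`, hence `|ω_gh n·(cK n·cQ n)| ≤ 4N²a·n¹⁰` — the letter
of the tolerance-`n¹⁰` rows `h₄∕h₅_of_scaling₁₀` with `k = 4N²a`. -/
theorem abs_weight₄_le_of_rayS (ha : 0 ≤ a) (hωs : ∀ n : ℕ, 2 ≤ n → ωgh n * (s n * cK n) ^ 2 = -2 * (ωgl n * cE n ^ 2))
    (hs : ∀ n : ℕ, 2 ≤ n → s n = ((n : ℝ) ^ 2)⁻¹)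
    (hlam : ∀ n : ℕ, 2 ≤ n → ωgl n * cE n ^ 2 = 2 * N ^ 2 * (n : ℝ) ^ 8)
    (hK : ∀ n : ℕ, cK n = cgh n * (n : ℝ) ^ 2) (hQ : ∀ n : ℕ, cQ n = cgh n * a) :
    ∀ n : ℕ, 2 ≤ n → |ωgh n * (cK n * cQ n)| ≤ 4 * N ^ 2 * a * (n : ℝ) ^ 10 := by
  intro n hn
  have h2 := ωgh_mul_cgh_sq_of_rayS hωs hs hlam hK n hn
  have e : ωgh n * (cK n * cQ n) = ωgh n * cgh n ^ 2 * ((n : ℝ) ^ 2 * a) := by rw [hK n, hQ n]; ring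
  rw [e, h2, show -(4 * N ^ 2 * (n : ℝ) ^ 8) * ((n : ℝ) ^ 2 * a) = -(4 * N ^ 2 * a * (n : ℝ) ^ 10) by ring, abs_neg,
    abs_of_nonneg (by positivity)]

/-- [folklore] The same product in the order `cQ·cK` (the letter of `h₅_of_scaling₁₀`). -/
theorem abs_weight₅_le_of_rayS (ha : 0 ≤ a) (hωs : ∀ n : ℕ, 2 ≤ n → ωgh n * (s n * cK n) ^ 2 = -2 * (ωgl n * cE n ^ 2))
    (hs : ∀ n : ℕ, 2 ≤ n → s n = ((n : ℝ) ^ 2)⁻¹)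
    (hlam : ∀ n : ℕ, 2 ≤ n → ωgl n * cE n ^ 2 = 2 * N ^ 2 * (n : ℝ) ^ 8)
    (hK : ∀ n : ℕ, cK n = cgh n * (n : ℝ) ^ 2) (hQ : ∀ n : ℕ, cQ n = cgh n * a) :
    ∀ n : ℕ, 2 ≤ n → |ωgh n * (cQ n * cK n)| ≤ 4 * N ^ 2 * a * (n : ℝ) ^ 10 := by
  intro n hn
  rw [mul_comm (cQ n)]
  exact abs_weight₄_le_of_rayS ha hωs hs hlam hK hQ n hn

/-- [folklore] **THE T₆ WEIGHT PRODUCT AT THE RAY, READING (ii)**: `|ω_gh n·(cQ n·cQ n)| ≤ 4N²a²·n⁸` — the letter of the tolerance-`n⁸` row `h₆_of_scaling₈`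
with `k = 4N²a²`. -/
theorem abs_weight₆_le_of_rayS (hωs : ∀ n : ℕ, 2 ≤ n → ωgh n * (s n * cK n) ^ 2 = -2 * (ωgl n * cE n ^ 2))
    (hs : ∀ n : ℕ, 2 ≤ n → s n = ((n : ℝ) ^ 2)⁻¹)
    (hlam : ∀ n : ℕ, 2 ≤ n → ωgl n * cE n ^ 2 = 2 * N ^ 2 * (n : ℝ) ^ 8)
    (hK : ∀ n : ℕ, cK n = cgh n * (n : ℝ) ^ 2) (hQ : ∀ n : ℕ, cQ n = cgh n * a) :
    ∀ n : ℕ, 2 ≤ n → |ωgh n * (cQ n * cQ n)| ≤ 4 * N ^ 2 * a ^ 2 * (n : ℝ) ^ 8 := by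
  intro n hn
  have h2 := ωgh_mul_cgh_sq_of_rayS hωs hs hlam hK n hn
  have e : ωgh n * (cQ n * cQ n) = ωgh n * cgh n ^ 2 * a ^ 2 := by rw [hQ n]; ring
  rw [e, h2, show -(4 * N ^ 2 * (n : ℝ) ^ 8) * a ^ 2 = -(4 * N ^ 2 * a ^ 2 * (n : ℝ) ^ 8) by ring, abs_neg,
    abs_of_nonneg (by positivity)]

end Summit.QuantumFields.BalabanUV.Beta.D1BFx.NeedleRowsAtRayS

end
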